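import Summits.AtomisticToContinuum.BoseEinsteinCondensation.Theorems.PeriodicToDirichlet.Negative.RewardedFreeGasAnchors

/-!
# Negative lemmas for crux `PeriodicToDirichlet` (stmt-AtomisticToContinuum-9483), rewarded free gas VI:
the un-rewarding of the free Dirichlet gas happens at the GAP SCALE `λ ≍ L_N⁻²`

Supports (does not close) stmt-AtomisticToContinuum-9483 (crux `PeriodicToDirichlet`, route
`BECThomsonPrinciple`), line `reward-pays-the-wall`, residual stub `Unrewarding` (the crux is
`Unrewarding → PeriodicToDirichlet` over the tree, `periodicToDirichlet_of_unrewarding`). Filed by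
the crux disprover (gen 4); imports part IV (`RewardedFreeGasAnchors`).

Part IV showed that at `v = 0` the rewarded anchors hold for every `c < 1` at every FIXED reward
`λ > 0` while at `λ = 0` the flat fraction is capped by `flatCap < 1`: the flat fraction of the free
Dirichlet gas jumps at `λ = 0⁺` after `N → ∞`. This part locates the jump: it sits EXACTLY at the
kinetic-gap scale `λ ≍ L_N⁻²` (`L_N = (N/ρ)^{1/3}`), uniformly over all near-minimisers.

* `RewardedBoxBECAlong v ρ λ_• c` — the anchors along a REWARD SEQUENCE `λ_N` (at a constant
  sequence it is `RewardedBoxBECAt`, `rewardedBoxBECAlong_const`);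
* `rewardedBoxBECAlong_zero_of_superGap` — **super-gap rewards condense fully**: if
  `λ_N L_N² → ∞` then `RewardedBoxBECAlong 0 ρ λ_• c` for EVERY `c < 1` (plateau states of part IV;
  part IV's fixed-`λ` theorem is the special case `λ_N = λ`);
* `rewardedInf_le_groundStateEnergy_add`, `energy_le_of_rewardedNearMin` — `F(λ) ≤ E₀ + λN` and
  the energy of a rewarded `δ`-near-minimiser is `≤ E₀ + λN + δ` (every `v`);
* `gapCap a < 1`, `occupation_flatMode_le_gapCap` — a free Dirichlet state with kinetic energy
  `≤ aN/L²` has flat occupation `≤ gapCap(a)·N` (part II's slab bound at `s = L/(4(a+1))`);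
* `flatMode_capped_of_gapScale` — **gap-scale rewards do not un-cap**: for `λ L² ≤ κ` EVERY
  `δ`-near-minimiser of `R_λ` with `δ ≤ N/L²` has flat occupation `≤ gapCap(𝓔₀[β] + κ + 1)·N`;
  `not_rewardedBoxBECAlong_zero_of_gapScale` — hence `¬ RewardedBoxBECAlong 0 ρ λ_• c` whenever
  eventually `λ_N L_N² ≤ κ` and `c > gapCap(𝓔₀[β] + κ + 1)`;
* `gapScale_dichotomy` — at `λ_N = L_N⁻¹` every `c < 1` is certified, at `λ_N = L_N⁻²` some
  `c₂ < 1` is not.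

READING (for the lead / the promote-stub dossier of `Unrewarding`). At `v = 0` the whole content
of un-rewarding lives in the window `0 ≤ λ ≲ L_N⁻² = ρ^{2/3} N^{-2/3}`: above it the rewarded
near-minimisers are flat-condensed with fraction `→ 1`, inside it the fraction stays bounded away
from `1` (numerically, for the exact one-body problem `-Δ_D − Λ|φ⟩⟨φ|` on the unit cube, the
ground-state flat fraction is `f(Λ) = 0.5326, 0.536, 0.562, 0.722, 0.905` at
`Λ = λL² = 0, 1, 10, 100, 1000`, with `1 − f ≈ 3/√Λ` for large `Λ`; crux workfile
`Cruxes/PeriodicToDirichlet/Disproof.lean` §10). So a proof of `Unrewarding` cannot treat `λ` as a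
macroscopic (per-particle, `N`-independent) energy scale down to `0`: the last stretch
`λ ∈ (0, O(L_N⁻²))` is a gap-scale problem, where for `v ≠ 0` no energy method certifies
condensation (barrier `KineticGapLengthScales`; `Barriers/…DirichletWindow`: one gap per particle is
exactly the admissible window on the Dirichlet side). Nothing here refutes `Unrewarding`
(`∃ c' > 0`; at `v = 0` its conclusion holds with any `c' < (8/π²)³`).
-/

noncomputable section

open MeasureTheory Filter Set Metric
open scoped ENNReal NNReal ComplexConjugate Topology

namespace Summit.AtomisticToContinuum.BoseEinsteinCondensation.Theorems.PeriodicToDirichlet.Negative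

open Literature.MathematicalPhysics.QuantumManyBody.BoseGas

/-! ## §1 Anchors along a reward sequence -/

/-- **Rewarded flat-mode BEC along a reward sequence** `λ_N`: eventually in `N` there is `δ > 0`
such that every `δ`-near-minimiser of `R_{λ_N}` in the box of side `L_N(ρ)` has flat occupation
`≥ cN`. At a constant sequence this is `RewardedBoxBECAt` (deliberately untagged: a hypothesis
shape of the line, not a result in print). -/
def RewardedBoxBECAlong (v : ℝ → ℝ≥0∞) (ρ : ℝ) (lam : ℕ → ℝ) (c : ℝ) : Prop :=
  ∀ᶠ N : ℕ in atTop, ∃ δ : ℝ≥0∞, 0 < δ ∧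
    ∀ Ψ : TrialState N (sideLength ρ N),
      rewardedEnergy v (lam N) Ψ ≤ rewardedInf v (lam N) N (sideLength ρ N) + δ →
        ENNReal.ofReal (c * N) ≤ occupation N (flatMode (sideLength ρ N)) Ψ.ψ

/-- At a constant reward sequence, `RewardedBoxBECAlong` is `RewardedBoxBECAt`. [folklore] -/
theorem rewardedBoxBECAlong_const (v : ℝ → ℝ≥0∞) (ρ lam c : ℝ) :
    RewardedBoxBECAlong v ρ (fun _ => lam) c ↔ RewardedBoxBECAt v ρ lam c :=
  Iff.rfl

/-- `RewardedBoxBECAlong` is monotone in the constant. [folklore] -/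
theorem RewardedBoxBECAlong.mono {v : ℝ → ℝ≥0∞} {ρ c c' : ℝ} {lam : ℕ → ℝ} (hcc' : c' ≤ c)
    (h : RewardedBoxBECAlong v ρ lam c) : RewardedBoxBECAlong v ρ lam c' := by
  refine Filter.Eventually.mono h fun N hN => ?_
  obtain ⟨δ, hδ, hΨ⟩ := hN
  refine ⟨δ, hδ, fun Ψ hE => le_trans ?_ (hΨ Ψ hE)⟩
  exact ENNReal.ofReal_le_ofReal (mul_le_mul_of_nonneg_right hcc' N.cast_nonneg)

/-! ## §2 Super-gap rewards condense fully (`v = 0`) -/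

/-- **Super-gap rewards condense the free Dirichlet gas fully.** If `λ_N L_N² → ∞` (and
`λ_N > 0` eventually) then `RewardedBoxBECAlong 0 ρ λ_• c` for EVERY `c < 1`: the plateau state
`u_η^{⊗N}` has `R_{λ_N} ≤ N𝓔₀[u_η]/L_N² + λ_N N(1 − (1−4η)⁶)` and `𝓔₀[u_η]/L_N² ≪ λ_N`, while
`R_λ(Ψ) ≥ λ(N − n_φ(Ψ))` for every `Ψ`. (Part IV's `rewardedBoxBECAt_zero_of_lt_one` is the case
of a constant sequence.) [folklore] -/
theorem rewardedBoxBECAlong_zero_of_superGap {ρ c : ℝ} {lam : ℕ → ℝ} (hρ : 0 < ρ) (hc : c < 1)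
    (hpos : ∀ᶠ N : ℕ in atTop, 0 < lam N)
    (hgrow : Tendsto (fun N : ℕ => lam N * sideLength ρ N ^ 2) atTop atTop) :
    RewardedBoxBECAlong 0 ρ lam c := by
  by_cases hc0 : c ≤ 0
  · refine Eventually.of_forall fun N => ⟨1, one_pos, fun Ψ _ => ?_⟩
    rw [ENNReal.ofReal_of_nonpos (mul_nonpos_of_nonpos_of_nonneg hc0 N.cast_nonneg)]
    exact bot_le
  replace hc0 : 0 < c := not_le.1 hc0
  -- the plateau parameter
  set η : ℝ := (1 - c) / 48 with hηdef
  have hη : 0 < η := by rw [hηdef]; linarith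
  have hη4 : η < 1 / 4 := by rw [hηdef]; linarith
  have hbern : (1 + c) / 2 ≤ (1 - 4 * η) ^ 6 := by
    have h := one_add_mul_le_pow (show (-2 : ℝ) ≤ -(4 * η) by linarith) 6
    have : (1 : ℝ) + (6 : ℕ) * -(4 * η) = (1 + c) / 2 := by rw [hηdef]; push_cast; ring
    rw [this] at h
    simpa [sub_eq_add_neg] using h
  -- the one-body energy of the plateau mode
  set K : ℝ≥0∞ := rawEnergy 0 (oneFun (plateauMode hη hη4)) with hK
  have hKtop : K ≠ ⊤ := rawEnergy_plateauMode_ne_top hη hη4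
  set Kr : ℝ := K.toReal with hKr
  have hKeq : K = ENNReal.ofReal Kr := (ENNReal.ofReal_toReal hKtop).symm
  have hKr0 : 0 ≤ Kr := ENNReal.toReal_nonneg
  have h1c : 0 < 1 - c := by linarith
  -- large `N`: `λ_N L_N² ≥ 4 Kr/(1 - c)`, `λ_N > 0`, `N > 0`
  filter_upwards [hgrow.eventually_ge_atTop (4 * Kr / (1 - c)), hpos, eventually_gt_atTop 0]
    with N hNM hlam hN
  obtain ⟨n, rfl⟩ : ∃ n, N = n + 1 := ⟨N - 1, by omega⟩
  set L := sideLength ρ (n + 1) with hL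
  set l : ℝ := lam (n + 1) with hl
  have hL0 : 0 < L := sideLength_pos_of_pos hρ hN
  have hLK : Kr / L ^ 2 ≤ l * (1 - c) / 4 := by
    rw [div_le_iff₀ (by positivity)]
    have h4 : 4 * Kr / (1 - c) ≤ l * L ^ 2 := hNM
    rw [div_le_iff₀ h1c] at h4
    nlinarith
  have hNpos : (0 : ℝ) < n + 1 := by positivity
  -- the slack
  refine ⟨ENNReal.ofReal (l * (n + 1) * (1 - c) / 4), by rw [ENNReal.ofReal_pos]; positivity,
    fun Ψ hΨ => ?_⟩
  set Φ := plateauBox hη hη4 (n + 1) hL0 with hΦ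
  -- energy and occupation of the plateau state
  have hEΦ : energy 0 Φ ≤ ENNReal.ofReal (l * (n + 1) * (1 - c) / 4) := by
    rw [hΦ, energy_plateauBox, ← hK, hKeq, show ((n + 1 : ℕ) : ℝ≥0∞) = ENNReal.ofReal (n + 1) by
        rw [← Nat.cast_succ (R := ℝ), ENNReal.ofReal_natCast],
      ← ENNReal.ofReal_mul (by positivity), ENNReal.ofReal_inv_of_pos (by positivity),
      ← ENNReal.div_eq_inv_mul, ← ENNReal.ofReal_div_of_pos (by positivity)]
    refine ENNReal.ofReal_le_ofReal ?_
    rw [div_le_iff₀ (by positivity)]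
    rw [div_le_iff₀ (by positivity)] at hLK
    nlinarith
  have hoccΦ : ENNReal.ofReal ((n + 1) * ((1 + c) / 2)) ≤
      occupation (n + 1) (flatMode L) Φ.ψ := by
    refine le_trans (ENNReal.ofReal_le_ofReal ?_) (occupation_plateauBox_ge hη hη4 n hL0)
    exact mul_le_mul_of_nonneg_left hbern hNpos.le
  -- the reward sandwich: `λ(N − n_φ(Ψ)) ≤ R_λ(Ψ) ≤ R_λ(Φ) + δ`
  have hcast : ((n + 1 : ℕ) : ℝ≥0∞) = ENNReal.ofReal (n + 1) := by
    rw [← Nat.cast_succ (R := ℝ), ENNReal.ofReal_natCast]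
  have hsub : ((n + 1 : ℕ) : ℝ≥0∞) - occupation (n + 1) (flatMode L) Φ.ψ ≤
      ENNReal.ofReal ((n + 1) * (1 - c) / 2) := by
    calc ((n + 1 : ℕ) : ℝ≥0∞) - occupation (n + 1) (flatMode L) Φ.ψ
        ≤ ENNReal.ofReal (n + 1) - ENNReal.ofReal ((n + 1) * ((1 + c) / 2)) := by
          rw [hcast]; exact tsub_le_tsub_left hoccΦ _
      _ = ENNReal.ofReal ((n + 1) * (1 - c) / 2) := by
          rw [← ENNReal.ofReal_sub _ (by positivity)]
          congr 1; ring
  have hchain : ENNReal.ofReal l * (((n + 1 : ℕ) : ℝ≥0∞) - occupation (n + 1) (flatMode L) Ψ.ψ) ≤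
      ENNReal.ofReal l * ENNReal.ofReal ((n + 1) * (1 - c)) := by
    calc ENNReal.ofReal l * (((n + 1 : ℕ) : ℝ≥0∞) - occupation (n + 1) (flatMode L) Ψ.ψ)
        ≤ rewardedEnergy 0 l Ψ := le_add_self
      _ ≤ rewardedInf 0 l (n + 1) L + ENNReal.ofReal (l * (n + 1) * (1 - c) / 4) := hΨ
      _ ≤ rewardedEnergy 0 l Φ + ENNReal.ofReal (l * (n + 1) * (1 - c) / 4) :=
          add_le_add (iInf_le _ Φ) le_rfl
      _ ≤ ENNReal.ofReal (l * (n + 1) * (1 - c) / 4) +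
            ENNReal.ofReal l * ENNReal.ofReal ((n + 1) * (1 - c) / 2) +
            ENNReal.ofReal (l * (n + 1) * (1 - c) / 4) := by
          unfold rewardedEnergy
          gcongr
      _ = ENNReal.ofReal l * ENNReal.ofReal ((n + 1) * (1 - c)) := by
          rw [← ENNReal.ofReal_mul hlam.le, ← ENNReal.ofReal_add (by positivity) (by positivity),
            ← ENNReal.ofReal_add (by positivity) (by positivity), ← ENNReal.ofReal_mul hlam.le]
          congr 1; ring
  have hlam0 : ENNReal.ofReal l ≠ 0 := by rwa [Ne, ENNReal.ofReal_eq_zero, not_le]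
  have hcancel : ((n + 1 : ℕ) : ℝ≥0∞) - occupation (n + 1) (flatMode L) Ψ.ψ ≤
      ENNReal.ofReal ((n + 1) * (1 - c)) :=
    (ENNReal.mul_le_mul_iff_right hlam0 ENNReal.ofReal_ne_top).1 hchain
  rw [tsub_le_iff_right, hcast] at hcancel
  -- `N = cN + (1 − c)N`
  have hsplit : ENNReal.ofReal (n + 1) = ENNReal.ofReal (c * (n + 1 : ℕ)) +
      ENNReal.ofReal ((n + 1) * (1 - c)) := by
    rw [← ENNReal.ofReal_add (by push_cast; positivity) (by positivity)]
    congr 1; push_cast; ring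
  rw [hsplit, add_comm (ENNReal.ofReal (c * _))] at hcancel
  exact (ENNReal.add_le_add_iff_left ENNReal.ofReal_ne_top).1 hcancel

/-- Part IV's fixed-`λ` anchors as the constant-sequence case (consistency check). [folklore] -/
example {ρ c lam : ℝ} (hρ : 0 < ρ) (hc : c < 1) (hlam : 0 < lam) : RewardedBoxBECAt 0 ρ lam c :=
  (rewardedBoxBECAlong_const 0 ρ lam c).1
    (rewardedBoxBECAlong_zero_of_superGap hρ hc (Eventually.of_forall fun _ => hlam)
      (Tendsto.const_mul_atTop hlam
        ((tendsto_pow_atTop two_ne_zero).comp (tendsto_sideLength_atTop hρ))))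

/-! ## §3 Energy of rewarded near-minimisers (every `v`) -/

/-- `R_λ(Ψ) ≤ ⟨Ψ,HΨ⟩ + λN` (the reward deficit is at most `N`). [folklore] -/
theorem rewardedEnergy_le_energy_add (v : ℝ → ℝ≥0∞) (lam : ℝ) {N : ℕ} {L : ℝ}
    (Ψ : TrialState N L) : rewardedEnergy v lam Ψ ≤ energy v Ψ + ENNReal.ofReal lam * N := by
  unfold rewardedEnergy
  gcongr
  exact tsub_le_self

/-- **`F^D(λ) ≤ E₀^D + λN`** for every `λ`, `N`, `L`, `v`. [folklore] -/
theorem rewardedInf_le_groundStateEnergy_add (v : ℝ → ℝ≥0∞) (lam : ℝ) (N : ℕ) (L : ℝ) :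
    rewardedInf v lam N L ≤ groundStateEnergy v N L + ENNReal.ofReal lam * N := by
  unfold rewardedInf groundStateEnergy
  rw [ENNReal.iInf_add]
  exact iInf_mono fun Ψ => rewardedEnergy_le_energy_add v lam Ψ

/-- **A rewarded `δ`-near-minimiser has energy `≤ E₀^D + λN + δ`.** [folklore] -/
theorem energy_le_of_rewardedNearMin (v : ℝ → ℝ≥0∞) {lam : ℝ} {N : ℕ} {L : ℝ} {δ : ℝ≥0∞}
    (Ψ : TrialState N L) (h : rewardedEnergy v lam Ψ ≤ rewardedInf v lam N L + δ) :
    energy v Ψ ≤ groundStateEnergy v N L + ENNReal.ofReal lam * N + δ :=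
  ((le_self_add (a := energy v Ψ)).trans h).trans
    (add_le_add (rewardedInf_le_groundStateEnergy_add v lam N L) le_rfl)

/-! ## §4 The cap from bounded kinetic energy (`v = 0`) -/

/-- The cap constant at kinetic energy `≤ aN/L²`: `gapCap a = (2 + σ/2)/(2 + σ)`,
`σ = 1/(4(a+1))`. [folklore] -/
def gapCap (a : ℝ) : ℝ :=
  (2 + 1 / (4 * (a + 1)) / 2) / (2 + 1 / (4 * (a + 1)))

/-- `gapCap a < 1` for `a ≥ 0`. [folklore] -/
theorem gapCap_lt_one {a : ℝ} (ha : 0 ≤ a) : gapCap a < 1 := by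
  unfold gapCap
  have hσ : 0 < 1 / (4 * (a + 1)) := by positivity
  rw [div_lt_one (by positivity)]
  linarith

/-- `0 < gapCap a` for `a ≥ 0`. [folklore] -/
theorem gapCap_pos {a : ℝ} (ha : 0 ≤ a) : 0 < gapCap a := by
  unfold gapCap
  positivity

/-- **Bounded kinetic energy caps the flat occupation.** A free Dirichlet trial state of
`N = n+1` bosons in `Λ_L` with `T(Ψ) ≤ aN/L²` has `n_φ(Ψ) ≤ gapCap(a)·N`
(`occupation_flatMode_le` of part II at `s = L/(4(a+1))`). [folklore] -/
theorem occupation_flatMode_le_gapCap {n : ℕ} {L a : ℝ} (hL : 0 < L) (ha : 0 ≤ a)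
    (Ψ : TrialState (n + 1) L)
    (hE : energy 0 Ψ ≤ ENNReal.ofReal (a * (n + 1) / L ^ 2)) :
    occupation (n + 1) (flatMode L) Ψ.ψ ≤ ENNReal.ofReal (gapCap a * (n + 1)) := by
  set σ : ℝ := 1 / (4 * (a + 1)) with hσ
  have hσ0 : 0 < σ := by positivity
  have hσ1 : σ ≤ 1 := by
    rw [hσ, div_le_one (by positivity)]; linarith
  have hs : 0 < σ * L := by positivity
  have hsL : σ * L ≤ L := by nlinarith
  have hNpos : (0 : ℝ) < n + 1 := by positivity
  have hcast : ((n : ℝ≥0∞) + 1) = ENNReal.ofReal (n + 1) := by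
    rw [← Nat.cast_succ (R := ℝ≥0∞), ← Nat.cast_succ (R := ℝ), ENNReal.ofReal_natCast]
  calc occupation (n + 1) (flatMode L) Ψ.ψ
      ≤ ENNReal.ofReal (2 * L / (2 * L + σ * L)) *
          ((n + 1 : ℝ≥0∞) + ENNReal.ofReal ((σ * L) ^ 2) * energy 0 Ψ) :=
        occupation_flatMode_le hL hs hsL Ψ
    _ ≤ ENNReal.ofReal (2 * L / (2 * L + σ * L)) *
          (ENNReal.ofReal (n + 1) + ENNReal.ofReal ((σ * L) ^ 2) *
            ENNReal.ofReal (a * (n + 1) / L ^ 2)) := by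
        rw [hcast]; gcongr
    _ = ENNReal.ofReal (2 * L / (2 * L + σ * L) * ((n + 1) + (σ * L) ^ 2 * (a * (n + 1) / L ^ 2))) := by
        rw [← ENNReal.ofReal_mul (by positivity), ← ENNReal.ofReal_add (by positivity) (by positivity),
          ← ENNReal.ofReal_mul (by positivity)]
    _ ≤ ENNReal.ofReal (gapCap a * (n + 1)) := by
        refine ENNReal.ofReal_le_ofReal ?_
        have hL2 : (σ * L) ^ 2 * (a * (n + 1) / L ^ 2) = σ ^ 2 * a * (n + 1) := by
          field_simp
        have hfrac : 2 * L / (2 * L + σ * L) = 2 / (2 + σ) := by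
          rw [show 2 * L + σ * L = (2 + σ) * L by ring, mul_div_mul_right _ _ hL.ne']
        rw [hL2, hfrac, gapCap, ← hσ]
        -- `(2/(2+σ)) (1 + σ²a) ≤ (2 + σ/2)/(2+σ)` since `σ a ≤ 1/4`
        have hσa : σ * a ≤ 1 / 4 := by
          rw [hσ, div_mul_eq_mul_div, one_mul, div_le_iff₀ (by positivity)]
          linarith
        have key : σ ^ 2 * a * (n + 1) ≤ σ * (n + 1) / 4 := by
          have h := mul_le_mul_of_nonneg_left hσa (by positivity : (0 : ℝ) ≤ σ * (n + 1))
          calc σ ^ 2 * a * (n + 1) = σ * (n + 1) * (σ * a) := by ring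
            _ ≤ σ * (n + 1) * (1 / 4) := h
            _ = σ * (n + 1) / 4 := by ring
        rw [div_mul_eq_mul_div, div_mul_eq_mul_div, div_le_div_iff_of_pos_right (by positivity)]
        nlinarith [key]

/-! ## §5 Gap-scale rewards do not un-cap (`v = 0`) -/

/-- **Every near-minimiser at a gap-scale reward is capped.** Free gas, box `Λ_L`, `N = n+1`:
if `0 ≤ λ`, `λL² ≤ κ` and `Ψ` is a `δ`-near-minimiser of `R_λ` with `δ ≤ N/L²`, then
`n_φ(Ψ) ≤ gapCap(𝓔₀[β] + κ + 1)·N`, `𝓔₀[β]` the energy of the unit bump (so that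
`E₀^D ≤ N𝓔₀[β]/L²`). Indeed `T(Ψ) ≤ E₀^D + λN + δ ≤ (𝓔₀[β] + κ + 1)N/L²`. [folklore] -/
theorem flatMode_capped_of_gapScale {n : ℕ} {L lam κ : ℝ} (hL : 0 < L) (hlam : 0 ≤ lam)
    (hκ : lam * L ^ 2 ≤ κ) {δ : ℝ≥0∞} (hδ : δ ≤ ENNReal.ofReal ((n + 1) / L ^ 2))
    (Ψ : TrialState (n + 1) L)
    (hΨ : rewardedEnergy 0 lam Ψ ≤ rewardedInf 0 lam (n + 1) L + δ) :
    occupation (n + 1) (flatMode L) Ψ.ψ ≤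
      ENNReal.ofReal (gapCap ((energy 0 unitBump).toReal + κ + 1) * (n + 1)) := by
  have hκ0 : 0 ≤ κ := le_trans (by positivity) hκ
  set K : ℝ := (energy 0 unitBump).toReal with hK
  have hK0 : 0 ≤ K := ENNReal.toReal_nonneg
  have hKeq : energy 0 unitBump = ENNReal.ofReal K :=
    (ENNReal.ofReal_toReal energy_unitBump_lt_top.ne).symm
  have hNpos : (0 : ℝ) < n + 1 := by positivity
  have hcast : ((n + 1 : ℕ) : ℝ≥0∞) = ENNReal.ofReal (n + 1) := by
    rw [← Nat.cast_succ (R := ℝ), ENNReal.ofReal_natCast]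
  refine occupation_flatMode_le_gapCap hL (by positivity) Ψ ?_
  -- energy bound
  have hE0 : groundStateEnergy 0 (n + 1) L ≤ ENNReal.ofReal (K * (n + 1) / L ^ 2) := by
    refine (groundStateEnergy_zero_le hL (n + 1)).trans (le_of_eq ?_)
    rw [hKeq, hcast, ← ENNReal.ofReal_mul (by positivity), ← ENNReal.ofReal_mul (by positivity)]
    congr 1
    field_simp
  have hlamN : ENNReal.ofReal lam * ((n + 1 : ℕ) : ℝ≥0∞) ≤ ENNReal.ofReal (κ * (n + 1) / L ^ 2) := by
    rw [hcast, ← ENNReal.ofReal_mul hlam]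
    refine ENNReal.ofReal_le_ofReal ?_
    rw [le_div_iff₀ (by positivity)]
    nlinarith
  calc energy 0 Ψ ≤ groundStateEnergy 0 (n + 1) L + ENNReal.ofReal lam * ((n + 1 : ℕ) : ℝ≥0∞) + δ :=
        energy_le_of_rewardedNearMin 0 Ψ hΨ
    _ ≤ ENNReal.ofReal (K * (n + 1) / L ^ 2) + ENNReal.ofReal (κ * (n + 1) / L ^ 2) +
          ENNReal.ofReal ((n + 1) / L ^ 2) := add_le_add (add_le_add hE0 hlamN) hδ
    _ = ENNReal.ofReal ((K + κ + 1) * (n + 1) / L ^ 2) := by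
        rw [← ENNReal.ofReal_add (by positivity) (by positivity),
          ← ENNReal.ofReal_add (by positivity) (by positivity)]
        congr 1; ring

/-- The rewarded infimum of the free gas is finite (`F(λ) ≤ E₀ + λN`, `E₀ ≤ N𝓔₀[β]/L² < ∞`).
[folklore] -/
theorem rewardedInf_zero_lt_top (lam : ℝ) {N : ℕ} {L : ℝ} (hL : 0 < L) :
    rewardedInf 0 lam N L < ⊤ := by
  refine (rewardedInf_le_groundStateEnergy_add 0 lam N L).trans_lt ?_
  refine ENNReal.add_lt_top.2 ⟨(groundStateEnergy_zero_le hL N).trans_lt ?_,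
    ENNReal.mul_lt_top ENNReal.ofReal_lt_top (ENNReal.natCast_lt_top N)⟩
  exact ENNReal.mul_lt_top ENNReal.ofReal_lt_top
    (ENNReal.mul_lt_top (ENNReal.natCast_lt_top N) energy_unitBump_lt_top)

/-- **Gap-scale rewards do not condense beyond the cap** (free gas, every density): if
`0 ≤ λ_N` and `λ_N L_N² ≤ κ` eventually, then `RewardedBoxBECAlong 0 ρ λ_• c` FAILS for every
`c > gapCap(𝓔₀[β] + κ + 1)`. Witness at each large `N`: any `min(δ, N/L_N²)`-near-minimiser of
`R_{λ_N}` (they exist, `F < ∞`), capped by `flatMode_capped_of_gapScale`. [folklore] -/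
theorem not_rewardedBoxBECAlong_zero_of_gapScale {ρ κ c : ℝ} {lam : ℕ → ℝ} (hρ : 0 < ρ)
    (hlam0 : ∀ᶠ N : ℕ in atTop, 0 ≤ lam N)
    (hlam : ∀ᶠ N : ℕ in atTop, lam N * sideLength ρ N ^ 2 ≤ κ)
    (hc : gapCap ((energy 0 unitBump).toReal + κ + 1) < c) :
    ¬ RewardedBoxBECAlong 0 ρ lam c := by
  intro h
  obtain ⟨N, hN, hl0, hl, δ, hδ, hΨ⟩ :=
    ((eventually_gt_atTop 0).and (hlam0.and (hlam.and h))).exists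
  obtain ⟨n, rfl⟩ : ∃ n, N = n + 1 := ⟨N - 1, by omega⟩
  set L := sideLength ρ (n + 1) with hL
  have hL0 : 0 < L := sideLength_pos_of_pos hρ hN
  have hNpos : (0 : ℝ) < n + 1 := by positivity
  -- a near-minimiser at slack `δ' = min δ (N/L²)`
  set δ' : ℝ≥0∞ := min δ (ENNReal.ofReal ((n + 1) / L ^ 2)) with hδ'
  have hδ'0 : δ' ≠ 0 := (lt_min hδ (by rw [ENNReal.ofReal_pos]; positivity)).ne'
  have hlt : rewardedInf 0 (lam (n + 1)) (n + 1) L < rewardedInf 0 (lam (n + 1)) (n + 1) L + δ' :=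
    ENNReal.lt_add_right (rewardedInf_zero_lt_top _ hL0).ne hδ'0
  obtain ⟨Ψ, hΨlt⟩ := iInf_lt_iff.mp hlt
  -- it is capped …
  have hcap := flatMode_capped_of_gapScale hL0 hl0 hl (min_le_right _ _) Ψ hΨlt.le
  -- … and certified by the hypothesis
  have hcert := hΨ Ψ (hΨlt.le.trans (add_le_add le_rfl (min_le_left _ _)))
  have hle := hcert.trans hcap
  push_cast at hle
  have hκ0 : 0 ≤ κ := le_trans (by positivity) hl
  have hK0 : 0 ≤ (energy 0 unitBump).toReal := ENNReal.toReal_nonneg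
  have hg0 : 0 < gapCap ((energy 0 unitBump).toReal + κ + 1) := gapCap_pos (by linarith)
  rw [ENNReal.ofReal_le_ofReal_iff (mul_nonneg hg0.le hNpos.le)] at hle
  have : c ≤ gapCap ((energy 0 unitBump).toReal + κ + 1) := le_of_mul_le_mul_right hle hNpos
  exact absurd hc (not_lt.2 this)

/-! ## §6 The dichotomy at `v = 0` -/

/-- **The gap-scale dichotomy of the rewarded free Dirichlet gas.** At every density:
rewards `λ_N = L_N⁻¹` (super-gap, still `o(1)` per particle) certify EVERY flat fraction `c < 1`;
rewards `λ_N = L_N⁻²` (gap scale) fail to certify some `c₂ < 1`. The un-rewarding of stub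
`Unrewarding` at `v = 0` therefore takes place entirely in the window `λ = O(L_N⁻²)`. [folklore] -/
theorem gapScale_dichotomy {ρ : ℝ} (hρ : 0 < ρ) :
    (∀ c : ℝ, c < 1 → RewardedBoxBECAlong 0 ρ (fun N => (sideLength ρ N)⁻¹) c) ∧
      ∃ c₂ : ℝ, c₂ < 1 ∧ ¬ RewardedBoxBECAlong 0 ρ (fun N => (sideLength ρ N ^ 2)⁻¹) c₂ := by
  have hLpos : ∀ᶠ N : ℕ in atTop, 0 < sideLength ρ N :=
    (eventually_gt_atTop 0).mono fun N hN => sideLength_pos_of_pos hρ hN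
  refine ⟨fun c hc => rewardedBoxBECAlong_zero_of_superGap hρ hc
      (hLpos.mono fun N hN => inv_pos.2 hN) ?_, ?_⟩
  · refine (tendsto_sideLength_atTop hρ).congr' (hLpos.mono fun N hN => ?_)
    field_simp
  · set K : ℝ := (energy 0 unitBump).toReal with hK
    have hK0 : 0 ≤ K := ENNReal.toReal_nonneg
    refine ⟨(gapCap (K + 1 + 1) + 1) / 2, by linarith [gapCap_lt_one (a := K + 1 + 1) (by linarith)],
      not_rewardedBoxBECAlong_zero_of_gapScale (κ := 1) hρ
        (Eventually.of_forall fun N => by positivity) (hLpos.mono fun N hN => ?_)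
        (by linarith [gapCap_lt_one (a := K + 1 + 1) (by linarith)])⟩
    rw [inv_mul_cancel₀ (pow_ne_zero 2 hN.ne')]

end Summit.AtomisticToContinuum.BoseEinsteinCondensation.Theorems.PeriodicToDirichlet.Negative

end
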